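import Mathlib.Algebra.Polynomial.Coeff
import Mathlib.Analysis.SpecialFunctions.Log.Base
import Mathlib.Analysis.SpecialFunctions.Pow.Real
import Literature.Computability.AlgebraicComplexity.AsymptoticSpectrum
import Literature.Computability.AlgebraicComplexity.SchoenhageTau
import HarnessLib

/-!
# Barrier: limits on the Universal Method applied to a fixed tensor (Alman 2021)

Topic `Literature/Barriers/MatrixMultiplication` (D-0021 barrier catalogue for the summit
`MatrixMultiplication`, `ω(ℂ) = 2`).

Source: J. Alman, *Limits on the Universal Method for Matrix Multiplication*, Theory of Computing
17 (2021), art. 1, 1–30 (CCC 2019), arXiv:1812.08731. Numbering of the ToC version (held,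
page-checked with `lit read`: §2.4 pp. 10–11, §2.5 p. 11, §2.6 pp. 11–13 with Thm. 2.7, Cor. 2.8,
Thm. 2.9 p. 13, Thm. 1.3 / Thm. 1.4 p. 4, §4.1 tables pp. 20–21, §4.2 p. 21–22).
History: the Universal/Galactic/Solar methods were defined by Alman–Vassilevska Williams (FOCS 2018),
who proved `ω_g(CW_q) ≥ c` for a universal constant `c > 2` [cite: AlmanVassilevskaWilliams2018, Thm. 1.1];
the first barrier of this kind, for the laser method with merging on `CW_q` (`≥ 2.3078` for `q = 5`),
is Ambainis–Filmus–Le Gall [cite: AmbainisFilmusLeGall2015, §1].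

## Catalogue entry

The D-0021 structured block (`technique_class / blocks / because / evasions_known / scope_caveats /
status`) is in the docstring of the catalogue declaration `UniversalMethodBarrier` at the end of this
file (the gate indexes declaration docstrings, not module docstrings).

## Content

* `PolyDegeneratesTo t s` — **degeneration** in the sense of Alman §2.4 (Strassen; Bini): maps
  `α : X₁ × X₂ → F[λ]`, `β`, `γ` and `h ∈ ℕ` such that substituting `x ↦ Σ_{x'} α(x,x') x'` (etc.) in
  `t` gives a tensor over `F[λ]` whose `λ^h`-coefficient is `s` and whose lower coefficients vanish.
  Between arbitrary finite formats (unlike the same-format orbit-closure `TensorDegeneratesTo` of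
  `QuantumFunctionals.lean`); restriction (`TensorRestrictsTo`) is the case `h = 0`
  (`TensorRestrictsTo.polyDegeneratesTo`, proved).
* `degenerationValue τ t = V_τ(T)` (Alman §2.5, after Coppersmith–Winograd): the supremum over
  `n ≥ 1` and degenerations `T^{⊗n} ⊵ ⊕ᵢ ⟨aᵢ,bᵢ,cᵢ⟩` of `(Σᵢ (aᵢbᵢcᵢ)^τ)^{1/n}`; the direct sum is the
  tree's `matMulDirectSum` (`SchoenhageTau.lean`), powers are `kroneckerPow`, `R̃` is
  `asymptoticRank` (`AsymptoticSpectrum.lean`).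
* `universalOmega t = ω_u(T)` — "the inf of `ω_u`, over all `ω_u ∈ [2,3]` such that
  `V_{ω_u/3}(T) ≥ R̃(T)`" (Alman §2.5, equivalent form of the §2.4 definition).
* `sliceRank`, `asymptoticSliceRank` (`S`, `S̃`, Alman §2.6), `IsVariableSymmetric` (§2.6).
* Named facts: `Alman2021_thm13` (`ω_u(CW_q) ≥ 2.16805`, all `q ≥ 1`, and `ω_u(CW_5) ≥ 2.21912`),
  `Alman2021_thm27` (`S̃(T) ≥ R̃(T)^{6/ω_u(T) − 2}`), `Alman2021_cor28` (`ω_u(T) = 2 ⇒ S̃(T) = R̃(T)`),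
  `Alman2021_thm29` (variable-symmetric: `ω_u(T) ≥ 2 log R̃(T) / log S̃(T)`).
* Catalogue entry `UniversalMethodBarrier : Prop` (conjunction of Thm. 2.9, Cor. 2.8, Thm. 1.3)
  carrying the D-0021 structured block, with projections.

## Design choices and wording risks

* `CW_q` is written INLINE (coordinates on `Fin (q+2)`, `q+1 = Fin.last (q+1)`), `rfl`-equal to
  `bigCwTensor K q` of the sibling barrier file `IrreversibilityBarrier.lean` (proposed separately;
  this file must elaborate on its own).
* Fields: Alman defines `ω` "over a field" and states (§1.2) "our bounds hold over every field"; the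
  facts quantify over all fields `K : Type` and finite index types in `Type`.
* `V_τ` is a real `sSup`; its defining set always contains `0` (the empty direct sum, `m = 0`), and
  for finite formats it is bounded by `(|X||Y||Z|)^{τ/2}` since degenerations do not increase
  flattening ranks (not proved here). Alman defines `V_τ` for `τ ∈ [2/3, 1]`; the definition is
  written for every real `τ` but only `τ = w/3`, `w ∈ [2,3]`, is ever used.
* `ω_u` is `sInf` of `{w ∈ [2,3] | R̃(T) ≤ V_{w/3}(T)} ∪ {3}`: the added `3` is the trivial bound
  `ω ≤ 3` and only fixes the value `3` (instead of the junk `0`) when NO `w ∈ [2,3]` qualifies; it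
  never changes the infimum otherwise (all members are `≤ 3`). Alman's `ω_u` is the infimum over
  the qualifying set itself (empty ⇒ undefined/`+∞`), and the printed proof of Thm. 2.9 starts from
  a qualifying degeneration; accordingly `Alman2021_thm29` carries the hypothesis "some `w ∈ [2,3]`
  qualifies" (`ω_u(T)` is defined), without which the encoded statement would say more than print
  (review of p6512). Thm. 2.7 / Cor. 2.8 / Thm. 1.3 are unaffected by the empty case.
* `sliceRank`/`asymptoticSliceRank` carry no finiteness binders: on infinite formats `sliceRank` is
  the junk `Nat.sInf ∅ = 0`; the bound `S(T) ≤ |X|` (`sliceRank_le_card`) and all facts concern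
  finite formats.
* Blocks `⟨aᵢ,bᵢ,cᵢ⟩` have `aᵢ, bᵢ, cᵢ ≥ 1` ("positive integers", §2.3).
* Thm. 2.7 / 2.9 involve `6/ω_u(T)` and `log S̃(T)`; they are vendored verbatim (real division and
  `Real.log`, natural for `ω_u ∈ [2,3]`, `S̃ ≥ 1`); Thm. 2.9 is read with the convention that a
  vanishing denominator makes the printed quotient meaningless, so it assumes `1 < S̃(T)`, and it
  assumes that `ω_u(T)` is defined (previous bullet) — both weaker than print, never stronger.
* Not vendored: Thm. 1.4 (needs "laser-ready" partitions, Def. 5.1), the `S̃` tables of §4 and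
  Thm. 3.2/3.4/3.9 (mechanism).
-/

noncomputable section

open scoped BigOperators Polynomial

namespace Literature.Barriers.MatrixMultiplication

universe u

/-! ## Degeneration between formats (Alman §2.4) -/

section Degeneration

variable {K : Type u} [CommSemiring K]
variable {ι κ μ ι' κ' μ' : Type*} [Fintype ι] [Fintype κ] [Fintype μ]

/-- **Degeneration** `t ⊵ s` (Alman 2021, §2.4): there are `h ∈ ℕ` and maps `α : X₁ × X₂ → K[λ]`,
`β : Y₁ × Y₂ → K[λ]`, `γ : Z₁ × Z₂ → K[λ]` such that the tensor over `K[λ]` obtained from `t` by the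
substitutions `x ↦ Σ_{x'} α(x,x') x'`, `y ↦ Σ_{y'} β(y,y') y'`, `z ↦ Σ_{z'} γ(z,z') z'` — whose
coefficient at `x'y'z'` is `Σ_{x,y,z} t_{xyz} α(x,x') β(y,y') γ(z,z')` — has `λ^h`-coefficient `s`
and vanishing `λ^{h'}`-coefficients for `h' < h`. [cite: Alman2021, §2.4] -/
def PolyDegeneratesTo (t : ι → κ → μ → K) (s : ι' → κ' → μ' → K) : Prop :=
  ∃ (h : ℕ) (A : ι → ι' → K[X]) (B : κ → κ' → K[X]) (C : μ → μ' → K[X]),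
    ∀ (a' : ι') (b' : κ') (c' : μ'), ∀ j ≤ h,
      (∑ a, ∑ b, ∑ c, Polynomial.C (t a b c) * (A a a' * B b b' * C c c')).coeff j =
        if j = h then s a' b' c' else 0

/-- A restriction is a degeneration (`h = 0`, constant polynomials; Alman §2.4: zeroing outs ⊆
monomial degenerations ⊆ degenerations, and restrictions likewise). [cite: Alman2021, §2.4] -/
theorem _root_.Literature.Computability.AlgebraicComplexity.TensorRestrictsTo.polyDegeneratesTo {t : ι → κ → μ → K} {s : ι' → κ' → μ' → K}
    (hts : Literature.Computability.AlgebraicComplexity.TensorRestrictsTo t s) : PolyDegeneratesTo t s := by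
  obtain ⟨A, B, C, hs⟩ := hts
  refine ⟨0, fun a a' => Polynomial.C (A a' a), fun b b' => Polynomial.C (B b' b),
    fun c c' => Polynomial.C (C c' c), fun a' b' c' j hj => ?_⟩
  obtain rfl : j = 0 := Nat.le_zero.1 hj
  simp only [if_true, Polynomial.finsetSum_coeff, ← Polynomial.C_mul, Polynomial.coeff_C_zero]
  rw [hs a' b' c']
  refine Finset.sum_congr rfl fun a _ => Finset.sum_congr rfl fun b _ =>
    Finset.sum_congr rfl fun c _ => ?_
  ring

end Degeneration

/-! ## Value, the Universal Method bound `ω_u`, slice rank (Alman §2.5–2.6) -/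

section Universal

variable {K : Type u} [Field K]
variable {ι κ μ : Type*} [Fintype ι] [Fintype κ] [Fintype μ]

variable (K) in
/-- The **`τ`-value** `V_τ(T)` (Alman 2021, §2.5, after Coppersmith–Winograd): the supremum over
positive `n` and all degenerations of `T^{⊗n}` into a direct sum `⊕_{i<m} ⟨aᵢ, bᵢ, cᵢ⟩` of matrix
multiplication tensors (`aᵢ, bᵢ, cᵢ ≥ 1`) of `(Σᵢ (aᵢ bᵢ cᵢ)^τ)^{1/n}`. Real `sSup` (junk `0` if the
set were unbounded). [cite: Alman2021, §2.5] -/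
def degenerationValue (τ : ℝ) (t : ι → κ → μ → K) : ℝ :=
  sSup {v : ℝ | ∃ n : ℕ, 0 < n ∧ ∃ (m : ℕ) (a b c : Fin m → ℕ),
    (∀ i, 0 < a i ∧ 0 < b i ∧ 0 < c i) ∧
      PolyDegeneratesTo (Literature.Computability.AlgebraicComplexity.kroneckerPow t n) (Literature.Computability.AlgebraicComplexity.matMulDirectSum K a b c) ∧
        v = (∑ i, ((a i * b i * c i : ℕ) : ℝ) ^ τ) ^ (1 / (n : ℝ))}

variable (K) in
/-- **`ω_u(T)`, the bound on `ω` from the Universal Method applied to `T`** (Alman 2021, §2.4: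
"the inf over all such `n` and degenerations [of `T^{⊗n}` into `⊕ᵢ ⟨aᵢ,bᵢ,cᵢ⟩`] of the resulting
upper bound on `ω` [by the asymptotic sum inequality `Σᵢ (aᵢbᵢcᵢ)^{ω/3} ≤ R̃(T)^n`]"; §2.5: "We can
then equivalently define `ω_u(T)` as the inf of `ω_u`, over all `ω_u ∈ [2, 3]` such that
`V_{ω_u/3}(T) ≥ R̃(T)`"). The trivial bound `3` is adjoined so that an empty qualifying set yields `3`.
[cite: Alman2021, §2.5] -/
def universalOmega (t : ι → κ → μ → K) : ℝ :=
  sInf ({w : ℝ | w ∈ Set.Icc (2 : ℝ) 3 ∧ Literature.Computability.AlgebraicComplexity.asymptoticRank t ≤ degenerationValue K (w / 3) t} ∪ {3})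

/-- `ω_u(T) ≤ 3` (the adjoined trivial bound). [folklore] -/
theorem universalOmega_le_three (t : ι → κ → μ → K) : universalOmega K t ≤ 3 := by
  refine csInf_le ⟨2, ?_⟩ (Set.mem_union_right _ rfl)
  rintro w (⟨⟨hw, _⟩, _⟩ | hw)
  · exact hw
  · rw [Set.mem_singleton_iff.1 hw]; norm_num

/-- `2 ≤ ω_u(T)` (all candidates lie in `[2, 3]`). [folklore] -/
theorem two_le_universalOmega (t : ι → κ → μ → K) : 2 ≤ universalOmega K t := by
  refine le_csInf ⟨3, Set.mem_union_right _ rfl⟩ ?_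
  rintro w (⟨⟨hw, _⟩, _⟩ | hw)
  · exact hw
  · rw [Set.mem_singleton_iff.1 hw]; norm_num

end Universal

section SliceRank

variable {K : Type u} [CommSemiring K]
variable {ι κ μ : Type*}

/-- **Slice rank** `S(T)` (Alman 2021, §2.6; Tao): the least `k = k_x + k_y + k_z` such that
`T = T_X + T_Y + T_Z` with `T_X` a sum of `k_x` tensors of `x`-rank one, `(Σ_x α_x x) ⊗ (Σ_{y,z} β_{yz} y⊗z)`
(entries `α a · β b c`), and similarly `T_Y`, `T_Z` in the other two directions. [cite: Alman2021, §2.6] -/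
def sliceRank (t : ι → κ → μ → K) : ℕ :=
  sInf {k : ℕ | ∃ kx ky kz : ℕ, kx + ky + kz = k ∧
    ∃ (α₁ : Fin kx → ι → K) (β₁ : Fin kx → κ → μ → K) (α₂ : Fin ky → κ → K)
      (β₂ : Fin ky → ι → μ → K) (α₃ : Fin kz → μ → K) (β₃ : Fin kz → ι → κ → K),
      t = fun a b c =>
        (∑ i, α₁ i a * β₁ i b c) + (∑ i, α₂ i b * β₂ i a c) + (∑ i, α₃ i c * β₃ i a b)}

/-- A slice decomposition with `kx + ky + kz` slices bounds `S(T)`. [cite: Alman2021, §2.6] -/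
theorem sliceRank_le_of_eq {t : ι → κ → μ → K} {kx ky kz : ℕ} (α₁ : Fin kx → ι → K)
    (β₁ : Fin kx → κ → μ → K) (α₂ : Fin ky → κ → K) (β₂ : Fin ky → ι → μ → K)
    (α₃ : Fin kz → μ → K) (β₃ : Fin kz → ι → κ → K)
    (h : t = fun a b c =>
      (∑ i, α₁ i a * β₁ i b c) + (∑ i, α₂ i b * β₂ i a c) + (∑ i, α₃ i c * β₃ i a b)) :
    sliceRank t ≤ kx + ky + kz :=
  Nat.sInf_le ⟨kx, ky, kz, rfl, α₁, β₁, α₂, β₂, α₃, β₃, h⟩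

/-- `S(T) ≤ |X|`: slicing along every `x`-coordinate (Alman Lemma 2.1(5)). [cite: Alman2021, Lemma 2.1] -/
theorem sliceRank_le_card [Fintype ι] (t : ι → κ → μ → K) : sliceRank t ≤ Fintype.card ι := by
  classical
  set e := Fintype.equivFin ι
  have h := sliceRank_le_of_eq (t := t) (kx := Fintype.card ι) (ky := 0) (kz := 0)
    (fun i a => if e a = i then 1 else 0) (fun i b c => t (e.symm i) b c)
    Fin.elim0 Fin.elim0 Fin.elim0 Fin.elim0 ?_
  · simpa using h
  · funext a b c
    simp only [Finset.univ_eq_empty, Finset.sum_empty, add_zero]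
    rw [Finset.sum_eq_single (e a)]
    · simp
    · intro i _ hi
      simp [Ne.symm hi]
    · simp

/-- **Asymptotic slice rank** `S̃(T) = sup_{n ≥ 1} S(T^{⊗n})^{1/n}` (Alman 2021, §2.6). Real `iSup`
over `n + 1` (bounded by `|X|`, cf. `sliceRank_le_card`; junk `0` only if unbounded).
[cite: Alman2021, §2.6] -/
def asymptoticSliceRank (t : ι → κ → μ → K) : ℝ :=
  ⨆ n : ℕ, ((sliceRank (Literature.Computability.AlgebraicComplexity.kroneckerPow t (n + 1)) : ℝ) ^ (1 / ((n : ℝ) + 1)))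

/-- `S̃(T) ≥ 0`. [folklore] -/
theorem asymptoticSliceRank_nonneg (t : ι → κ → μ → K) : 0 ≤ asymptoticSliceRank t :=
  Real.iSup_nonneg fun n => by positivity

/-- **Variable-symmetric** tensor (Alman 2021, §2.6): `|X| = |Y| = |Z|` and the coefficient of
`xᵢ yⱼ z_k` equals that of `xⱼ y_k zᵢ`. [cite: Alman2021, §2.6] -/
def IsVariableSymmetric (t : ι → ι → ι → K) : Prop :=
  ∀ i j k, t i j k = t j k i

end SliceRank

/-! ## Named facts (Alman 2021, Thm. 2.7, Cor. 2.8, Thm. 2.9, Thm. 1.3) -/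

section Facts

/-- **Alman 2021, Theorem 2.7**: for any tensor `T` (over any field), `S̃(T) ≥ R̃(T)^{6/ω_u(T) − 2}`.
[cite: Alman2021, Thm. 2.7] -/
def Alman2021_thm27 : Prop :=
  ∀ (K : Type) [Field K] {ι κ μ : Type} [Fintype ι] [Fintype κ] [Fintype μ] (t : ι → κ → μ → K),
    Literature.Computability.AlgebraicComplexity.asymptoticRank t ^ (6 / universalOmega K t - 2) ≤ asymptoticSliceRank t

/-- **Alman 2021, Corollary 2.8** (first part): if `ω_u(T) = 2` then `S̃(T) = R̃(T)`.
[cite: Alman2021, Cor. 2.8] -/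
def Alman2021_cor28 : Prop :=
  ∀ (K : Type) [Field K] {ι κ μ : Type} [Fintype ι] [Fintype κ] [Fintype μ] (t : ι → κ → μ → K),
    universalOmega K t = 2 → asymptoticSliceRank t = Literature.Computability.AlgebraicComplexity.asymptoticRank t

/-- **Alman 2021, Theorem 2.9**: for a variable-symmetric tensor `T`,
`ω_u(T) ≥ 2 log(R̃(T)) / log(S̃(T))` — read for `S̃(T) > 1` (meaningful quotient) and for `T` such
that `ω_u(T)` is defined, i.e. some `w ∈ [2,3]` has `V_{w/3}(T) ≥ R̃(T)` (the printed proof begins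
"by definition of `ω_u`, … there is a positive integer `n` such that `T^{⊗n}` has a degeneration to
`F ⊙ ⟨a,b,c⟩` …"). [cite: Alman2021, Thm. 2.9] -/
def Alman2021_thm29 : Prop :=
  ∀ (K : Type) [Field K] {ι : Type} [Fintype ι] (t : ι → ι → ι → K), IsVariableSymmetric t →
    1 < asymptoticSliceRank t →
      (∃ w ∈ Set.Icc (2 : ℝ) 3, Literature.Computability.AlgebraicComplexity.asymptoticRank t ≤ degenerationValue K (w / 3) t) →
        2 * Real.log (Literature.Computability.AlgebraicComplexity.asymptoticRank t) / Real.log (asymptoticSliceRank t) ≤ universalOmega K t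

/-- **Alman 2021, Theorem 1.3** ("`ω_u(CW_q) ≥ 2.16805` for all `q`"), together with the printed
value for `q = 5` (§1.1 and §4.1: `ω_u(CW_5) ≥ 2.21912`): no analysis of the Coppersmith–Winograd
tensor `CW_q = x₀y₀z_{q+1} + x₀y_{q+1}z₀ + x_{q+1}y₀z₀ + Σ_{i=1}^q (xᵢyᵢz₀ + xᵢy₀zᵢ + x₀yᵢzᵢ)` within
the Universal Method proves a bound on `ω` better than `2.16805` (over any field, every `q ≥ 1`).
`CW_q` is written inline on `Fin (q+2)` (`= bigCwTensor K q`). [cite: Alman2021, Thm. 1.3] -/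
def Alman2021_thm13 : Prop :=
  ∀ (K : Type) [Field K] (q : ℕ), 1 ≤ q →
    let CW : Fin (q + 2) → Fin (q + 2) → Fin (q + 2) → K := fun a b c =>
      if (a = 0 ∧ b = c ∧ b ≠ 0 ∧ b ≠ Fin.last (q + 1)) ∨
          (b = 0 ∧ a = c ∧ a ≠ 0 ∧ a ≠ Fin.last (q + 1)) ∨
          (c = 0 ∧ a = b ∧ a ≠ 0 ∧ a ≠ Fin.last (q + 1)) ∨
          (a = 0 ∧ b = 0 ∧ c = Fin.last (q + 1)) ∨
          (a = 0 ∧ b = Fin.last (q + 1) ∧ c = 0) ∨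
          (a = Fin.last (q + 1) ∧ b = 0 ∧ c = 0) then 1 else 0
    (2.16805 : ℝ) ≤ universalOmega K CW ∧ (q = 5 → (2.21912 : ℝ) ≤ universalOmega K CW)

variable {K : Type} [Field K] {ι κ μ : Type} [Fintype ι] [Fintype κ] [Fintype μ]

/-- Cor. 2.8 in contrapositive, usable form: a tensor with `S̃(T) ≠ R̃(T)` (e.g. `S̃(T) < R̃(T)`)
cannot show `ω = 2` within the Universal Method: `ω_u(T) > 2`. [cite: Alman2021, Cor. 2.8] -/
theorem Alman2021_cor28.two_lt (h : Alman2021_cor28) (t : ι → κ → μ → K)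
    (hne : asymptoticSliceRank t ≠ Literature.Computability.AlgebraicComplexity.asymptoticRank t) : 2 < universalOmega K t :=
  lt_of_le_of_ne (two_le_universalOmega t) fun h2 => hne (h K t h2.symm)

end Facts

/-! ## Catalogue entry (D-0021) -/

section Catalogue

/-- **Limits on the Universal Method for a fixed tensor (Alman 2021).** The catalogue entry bundles
the mechanism (Thm. 2.9, variable-symmetric tensors; Cor. 2.8) with the headline bound for the
Coppersmith–Winograd tensors (Thm. 1.3).

BARRIER
technique_class: universal-method, galactic-method, solar-method, laser-method, degeneration, monomial-degeneration, zeroing-out, coppersmith-winograd, CW-tensor, asymptotic-sum-inequality, fixed-intermediate-tensor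
blocks: certifying `MatrixMultiplication` (`ω = 2`) — indeed any bound `ω < 2.16805` — by the Universal Method applied to `T = CW_q` (any `q ≥ 1`), the family "which has yielded all the best known bounds on `ω` since the 80s" [cite: Alman2021, §2.4]: bound `R̃(T)`, degenerate powers `T^{⊗n}` (arbitrary `F[λ]`-degenerations; monomial degenerations = Galactic, zeroing outs = Solar; the laser method with all refinements and the group-theoretic method producing zeroing outs of a fixed tensor are special cases) into disjoint sums `⊕ᵢ ⟨aᵢ,bᵢ,cᵢ⟩` and apply `Σᵢ (aᵢbᵢcᵢ)^{ω/3} ≤ R̃(T)^n`; result: `ω_u(CW_q) ≥ 2.16805` for all `q`, `ω_u(CW_5) ≥ 2.21912` [cite: Alman2021, Thm. 1.3 and §4.1]; the same numbers for the generalized `CW_{q,σ}` and `≥ 2.02538` for the small `cw_{q,σ}`, `q ≥ 3` [cite: Alman2021, §4.1–4.2]; generally `ω_u(T) > 2` whenever `S̃(T) ≠ R̃(T)` (`Alman2021_cor28.two_lt`) [cite: Alman2021, Cor. 2.8]; historically the first such barrier is Ambainis–Filmus–Le Gall's for the laser method with merging on `CW_q` (`≥ 2.3078`, `q = 5`) [cite: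 AmbainisFilmusLeGall2015, §1], then Alman–Vassilevska Williams' `ω_g(CW_q) ≥ c > 2` [cite: AlmanVassilevskaWilliams2018, Thm. 1.1].
because: degenerations cannot increase asymptotic slice rank `S̃` (Tao–Sawin) while `S̃(⟨a,b,c⟩) = abc / max{a,b,c}` (Strassen), so `S̃(T) ≥ R̃(T)^{6/ω_u(T) − 2}` (Thm. 2.7) and, for variable-symmetric `T`, `ω_u(T) ≥ 2 log R̃(T) / log S̃(T)` (Thm. 2.9); the upper bounds `S̃(CW_q) ≤ sup_{v ∈ [0,1/3]} q^{2(1/3−v)} / (v^v (2/3−2v)^{2/3−2v} (1/3+v)^{1/3+v})` (`2.7551` at `q = 1`) come from a partition/probability-distribution argument (Thm. 3.4, Prop. 3.8) [cite: Alman2021, §2.6 / §3 / §4.1].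
evasions_known: (i) tensors with `S̃(T) = R̃(T)` are not obstructed, e.g. the small `cw_2`: the `ω_u`-lower bound of §4.2 equals `2` at `q = 2`, and `R̃(cw_2) = 3` would imply `ω = 2` (sic: Alman writes "`= 2`") [cite: Alman2021, §4.2] [cite: ChristandlVranaZuiddam2021, Rem. 20]; (ii) sequences of different intermediate tensors are not covered by a fixed-`T` bound [cite: ChristandlVranaZuiddam2021, §3.1]; (iii) the Laser Method is complete for this question: for a laser-ready `T`, `ω_u(T) = 2` iff the Laser Method applied to `T` (first power) already yields `2` [cite: Alman2021, Thm. 1.4]; none published that beats `2.16805` with `CW_q`; (iv) the slice-rank route to LOWER bounds on `ω_u` is exhausted on laser-ready carriers: for every tensor with a laser-ready partition (Def. 5.1: blocks degenerating to maximal matrix multiplication tensors, `i + j + k = ℓ`, symmetric — `CW_{q,σ}`, `cw_{q,σ}`, `T_q^{lower}`) the partition bound of Thm. 3.4 on `S̃` is attained and `S̃(T) = Q̃(T)` ("for these tensors `T`, no better lower bound on `ω_u(T)` is possible by arguing only about `S̃(T)`"), so `2.16805…` is the limit of the method of proof, not a computed value: the numbers `ω_u(CW_q)` themselves are open (e.g.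 `2.21912 ≤ ω_u(CW_5) ≤ 2.371339`, the record bound on `ω`, obtained from `CW_5`) [cite: Alman2021, §1.2 (p. 7), Def. 5.1 and Cor. 5.4–5.5] [cite: AlmanDuanVassilevskaWilliamsXuXuZhou2025, §1]; (v) the record algorithms since 2023 (asymmetric hashing; `ω < 2.371339`) undercut the NARROW Ambainis–Filmus–Le Gall limit `2.3725` stated for the recursive laser method on the powers `CW_5^{⊗2^k}`, are described by their authors as still facing the `2.3078` limit of the laser method (with merging) on `CW_5`, and in any case stay inside this entry: their output is an `F[λ]`-degeneration of (independent copies of) `CW_5^{⊗N}` into independent matrix products followed by the asymptotic sum inequality, i.e. the Universal Method applied to `CW_5` [cite: AmbainisFilmusLeGall2015, §1] [cite: AlmanDuanVassilevskaWilliamsXuXuZhou2025, §1 and §2.5] [cite: VassilevskaWilliamsXuXuZhou2024, §3.3 and §4.1]; (vi) other FIXED carriers are untouched by the numbers of Thm. 1.3 and are obstructed by Cor. 2.8 only where `S̃(T) < R̃(T)` is certified (scope caveat (e)); carriers named in print as still able to give `ω = 2`: `cw_2` (`R̃(cw_2) = 3 ⟹ ω = 2`; 2026 state `R̃(cw_2)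 < 3.931 < 4 = bR(cw_2)` and `R̃(cw_q) < q + 2 − δ_q` for all `q ≥ 2`, "There is no known barrier like this to using `cw_q`" — for `q ≥ 3` the bound `ω_u(cw_q) ≥ 2.02538` of §4.2, which uses only `R̃(cw_q) ≥ q + 1`, stands) [cite: AlmanLi2026, §1 and Thm. 1.3] [cite: Alman2021, §4.2] [cite: CoppersmithWinograd1990, §11], the skew cousin `T_skewcw,2` ("the known barriers do not apply to `T_skewcw,2` for proving `ω = 2`"), `det₃ ≅ T_skewcw,2^{⊠2}` and `perm₃ ≅ cw_2^{⊠2}` [cite: ConnerGesmundoLandsbergVentura2022, §1 and §2.2, Lemma 2.10 (arXiv numbering)].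
scope_caveats: (a) `ω_u` is formalised through the value form of §2.5 with the trivial bound `3` adjoined for the (in print undefined) case of an empty qualifying set; Thm. 2.9 is vendored only for `T` with `ω_u(T)` defined and `S̃(T) > 1` [cite: Alman2021, §2.5 and Thm. 2.9]; (b) degeneration is Alman's algebraic `F[λ]` notion between arbitrary formats (`PolyDegeneratesTo`), not the tree's same-format orbit closure; (c) `CW_q` is written inline (equal to `bigCwTensor` of `IrreversibilityBarrier.lean`); (d) Thm. 1.4 (laser-ready tensors), the `S̃` tables of §4 and Thm. 3.2/3.4/3.9 are not vendored, and all vendored statements are named facts, not proved in THIS file — they are proved in the sibling files (see `status`) [cite: Alman2021, Thm. 1.4 and §4]; (e) EFFECTIVE REACH (audit 2026-08-16): the usable form `UniversalMethodBarrier.two_lt` needs `S̃(T) ≠ R̃(T)`; every certificate in print bounds `R̃` from below by a flattening rank and `S̃` from above by the partition bound of Thm. 3.4 / Prop. 3.8 (a minimum of support/quantum-functional bounds), and for a concise `T ∈ ℂ^{N×N×N}` the asymptotic slice rank is `< N` iff `T` is UNSTABLE (`0` in the closure of its `SL×SL×SL`-orbit) [cite: BlaserLysikov2020, Def. 2 and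 Thm. 3] [cite: Alman2021, Thm. 3.4, Prop. 3.8 and §4]; hence over `ℂ` a concise cubic carrier with `ω_u(T) = 2` is semistable of minimal asymptotic rank `R̃(T) = N`, the entry obstructs the unstable fixed carriers (`CW_{q,σ}` for all `q ≥ 1`, `cw_{q,σ}` for `q ≥ 3`, `T_q^{lower}`, `W = CW_0`) and says nothing about semistable ones (`⟨n,n,n⟩`, `cw_2`, `T_skewcw,2`, `det₃`, `perm₃`, group tables `⟨G⟩`, generic tensors) nor about SEQUENCES of carriers of growing size, e.g. sub-tensors `T′ ⊴ CW_q^{⊗N}` re-costed by their own `R̃(T′) < (q+2)^N` ("to do this, we need to consider a sequence of tensors with increasing size") [cite: BlaserLysikov2020, §1.2 (p. 3) and §4 (p. 9)] [cite: ChristandlVranaZuiddam2021, §3.1]; (f) the tags `laser-method`, `degeneration`, `monomial-degeneration`, `zeroing-out`, `asymptotic-sum-inequality` are obstructed only in conjunction with `fixed-intermediate-tensor` = `CW_{q,σ}` (the numbers of Thm. 1.3) or a carrier with certified `S̃ < R̃` (Cor. 2.8, no number); Kronecker products or direct sums of `CW_q` with other tensors are different carriers, to which only Cor. 2.8 / Thm.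 2.7 / Thm. 2.9 apply with their own `R̃` and `S̃` [cite: Alman2021, Cor. 2.8 and Thm. 1.3].
status: theorem (established) [cite: Alman2021, Thm. 1.3]; obtained independently via irreversibility / asymptotic subrank [cite: ChristandlVranaZuiddam2021, Thm. 9 and Thm. 22]; PROVED in the tree: `UniversalMethodBarrier_holds` (`UniversalMethodBarrierProofs.lean`, assembling `Alman2021_thm29_holds` / `Alman2021_cor28_holds` / `Alman2021_thm13_holds` of `…Thm29.lean`, `…Cor28.lean`, `…CwNumerics.lean`; axioms `propext`/`Classical.choice`/`Quot.sound`; barrier audit 2026-08-16: confirmed, block sharpened with evasions (iv)–(vi) and caveats (e)–(f)) [cite: Alman2021, Thm. 1.3]; 2026 context: first asymptotic-rank drop on the unobstructed carrier, `R̃(cw_2) < 3.931` [cite: AlmanLi2026, Thm. 1.3] -/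
def UniversalMethodBarrier : Prop :=
  Alman2021_thm29 ∧ Alman2021_cor28 ∧ Alman2021_thm13

/-- Projection: the slice-rank mechanism for variable-symmetric tensors. [cite: Alman2021, Thm. 2.9] -/
theorem UniversalMethodBarrier.thm29 (h : UniversalMethodBarrier) : Alman2021_thm29 := h.1

/-- Projection: `ω_u(T) = 2 ⇒ S̃(T) = R̃(T)`. [cite: Alman2021, Cor. 2.8] -/
theorem UniversalMethodBarrier.cor28 (h : UniversalMethodBarrier) : Alman2021_cor28 := h.2.1

/-- Projection: the Coppersmith–Winograd numerics. [cite: Alman2021, Thm. 1.3] -/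
theorem UniversalMethodBarrier.thm13 (h : UniversalMethodBarrier) : Alman2021_thm13 := h.2.2

/-- The catalogue entry in usable contrapositive form: within the Universal Method a fixed tensor
with `S̃(T) ≠ R̃(T)` never certifies `ω = 2` (`ω_u(T) > 2`). [cite: Alman2021, Cor. 2.8] -/
theorem UniversalMethodBarrier.two_lt (h : UniversalMethodBarrier) {K : Type} [Field K]
    {ι κ μ : Type} [Fintype ι] [Fintype κ] [Fintype μ] (t : ι → κ → μ → K)
    (hne : asymptoticSliceRank t ≠ Literature.Computability.AlgebraicComplexity.asymptoticRank t) : 2 < universalOmega K t :=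
  h.cor28.two_lt t hne

end Catalogue

end Literature.Barriers.MatrixMultiplication

end
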